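import Literature.AnabelianGeometry.EtaleTheta.TemperedRigidity
import Literature.AnabelianGeometry.EtaleTheta.ThetaLiftUnique
import HarnessLib

/-!
# [EtTh] Thm. 1.6 (ii): the CANONICAL valuation datum, the identity companion, and the instance-sensitivity
# of the typed `Thm16ii` in its `ValuationHatData` parameters (owner's soundness note on FACT-LIST F-0586)

Mochizuki, *The étale theta function …*, Publ. RIMS **45** (2009) [EtTh], §1, Thm. 1.6 (ii), PRIMS PDF
p. 24 (printed 250) [cite: MochizukiEtTh2009, Thm 1.6 (ii) p.24]: "`γ` induces an isomorphism
`H¹(G_{K̈α}, (Δ_Θ)α) →̃ H¹(G_{K̈β}, (Δ_Θ)β)` that preserves both the kernel of these surjections [the maps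
`(K̈^×)^∧ ↠ Ẑ` determined by the valuations] and the elements `1 ∈ Ẑ`". Layer L2 of the abc-iut cell,
seat abc-iut-L2-t1 (§1 interface owner); ADDITIVE soundness note on the typing `ThetaSetting.Thm16ii`
(`TemperedRigidity.lean`, FACT-LIST F-0586), in the wake of the `NonCuspidalPoint` vacuity findings
(F-d1g4-1, F-w5d140-3): a second place where §1 was typed over a FREE datum.

WHAT. `Thm16ii γ h Eα Eβ Vα Vβ` takes the kernel of "`(K̈^×)^∧ ↠ Ẑ`" as a PARAMETER
`V : ValuationHatData D E` (field `unitsHat`, pinned only on `K̈^× ⊆ (K̈^×)^∧` by `mem_unitsHat_iff`). In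
print that kernel is CANONICAL — the closure of `O^×_K̈`, i.e. (since `O^×_K̈` is profinite) the image of
`O^×_K̈` itself: `ValuationHatData.canonical`. This file records, kernel-checked:
* `ValuationHatData.canonical E` — the printed datum (so the parameter type is inhabited canonically);
* `ThetaCompanion.ofRefl`, `thm16i_refl`, `transport_refl` — along the identity `γ = id` the companion is
  forced to be the identity on `(Π^tp_X)^Θ` (`toTheta` is onto) and cohomology transport is the identity;
* `thm16ii_refl` — `Thm16ii` HOLDS at `γ = id` with EQUAL valuation data on both sides (sanity: the typed
  fact is consistent at the identity);
* `not_thm16ii_refl_of_ne` — but it FAILS at `γ = id` for two valuation data with different `unitsHat`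
  (clause (a) forces `δ = id` by injectivity of inflation and of the Kummer map, then clause (b) forces
  `Vα.unitsHat = Vβ.unitsHat`). Hence F-0586 is a SCHEMA to be consumed at the canonical instance
  `V := ValuationHatData.canonical _` (or with `Vα`, `Vβ` tied to the valuations), never with arbitrary
  `V`-parameters — the universal closure over `V` is refutable wherever two distinct data exist. Its only
  consumer today derives it as a CONCLUSION (`Thm16SubdagTransport.thm16ii_of_inputs`), so nothing
  downstream is affected.
No instances, no new Prop facts; nothing of [EtTh] asserted; no side taken on [IUTchIII] Cor. 3.12.
-/

noncomputable section

namespace Literature.AnabelianGeometry.EtaleTheta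

open Literature.AnabelianGeometry.SemiGraphs

namespace ThetaSetting

variable {p : ℕ} [Fact p.Prime] {D : ThetaSetting p}

/-! ### The canonical valuation datum -/

/-- **The canonical kernel of `(K̈^×)^∧ ↠ Ẑ`**: the image of `O^×_K̈` in `(K̈^×)^∧` ("determined by the
valuations on `K̈`", p. 24; `O^×_K̈` is profinite, hence closed in the completion). [cite: MochizukiEtTh2009, Thm 1.6 (ii) p.24] -/
def ValuationHatData.canonical (E : D.KummerData) : ValuationHatData D E where
  unitsHat := D.unitsOKdd.map E.toKddHat
  mem_unitsHat_iff a := by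
    constructor
    · rintro ⟨b, hb, hba⟩
      rwa [← E.toKddHat_injective hba]
    · exact fun ha => ⟨a, ha, rfl⟩

/-- [cite: MochizukiEtTh2009, Thm 1.6 (ii) p.24] -/
theorem ValuationHatData.canonical_unitsHat (E : D.KummerData) :
    (ValuationHatData.canonical E).unitsHat = D.unitsOKdd.map E.toKddHat := rfl

/-! ### The identity: companion and transport -/

variable (D) in
/-- The identity companion of `γ = id` (Thm. 1.6 (ii) at `α = β`, `γ = id`). [cite: MochizukiEtTh2009, Thm 1.6 (ii) p.24] -/
def ThetaCompanion.ofRefl : ThetaCompanion (ContinuousMulEquiv.refl D.PiTemp) where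
  thetaIso := ContinuousMulEquiv.refl D.GtpTheta
  comm _ := rfl
  map_deltaTheta := Subgroup.map_id _

variable (D) in
/-- Thm. 1.6 (i) holds for `γ = id`. [cite: MochizukiEtTh2009, Thm 1.6 (i) p.24] -/
theorem thm16i_refl : Thm16i (ContinuousMulEquiv.refl D.PiTemp) := Subgroup.map_id _

/-- **Companions of the identity are trivial**: `toTheta` is onto, so `γ^Θ = id`.
[cite: MochizukiEtTh2009, Thm 1.6 (ii) p.24] -/
theorem ThetaCompanion.thetaIso_apply_of_refl (c : ThetaCompanion (ContinuousMulEquiv.refl D.PiTemp))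
    (z : D.GtpTheta) : c.thetaIso z = z := by
  obtain ⟨x, rfl⟩ := D.toTheta_surjective z
  exact (c.comm x).symm

/-- **Cohomology transport along the identity is the identity** (for any companion of `id` and any proof
of Thm. 1.6 (i)). [cite: MochizukiEtTh2009, Thm 1.6 (iii) p.24] -/
theorem transport_refl (c : ThetaCompanion (ContinuousMulEquiv.refl D.PiTemp))
    (h : Thm16i (ContinuousMulEquiv.refl D.PiTemp)) (x : D.H1 D.GtpYdd) : transport c h x = x := by
  induction x using QuotientGroup.induction_on with
  | H f =>
    show (QuotientGroup.mk (transportCocycle c h f) : D.H1 D.GtpYdd) = QuotientGroup.mk f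
    congr 1
    apply Subtype.ext
    funext y
    apply Subtype.ext
    show (c.thetaIso (f.1 ⟨(ContinuousMulEquiv.refl D.PiTemp).toMulEquiv.symm y.1,
      symm_mem_GtpYdd h y⟩).1 : D.GtpTheta) = (f.1 y).1
    rw [c.thetaIso_apply_of_refl]
    rfl

/-! ### `Thm16ii` at the identity: consistent with equal data, refutable with distinct data -/

/-- **Sanity**: `Thm16ii` holds at `γ = id`, `α = β`, with the SAME Kummer and valuation data on both
sides (identity companion, `δ = id`). [cite: MochizukiEtTh2009, Thm 1.6 (ii) p.24] -/
theorem thm16ii_refl (E : D.KummerData) (V : ValuationHatData D E) :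
    Thm16ii (ContinuousMulEquiv.refl D.PiTemp) (thm16i_refl D) E E V V := by
  refine ⟨ThetaCompanion.ofRefl D, MulEquiv.refl _, fun a => ?_, ?_, fun ϖ hϖ => ⟨ϖ, hϖ, ?_⟩⟩
  · rw [transport_refl]; rfl
  · exact Subgroup.map_id _
  · rw [MulEquiv.refl_apply, mul_inv_cancel]
    exact V.unitsHat.one_mem

/-- **Instance-sensitivity of F-0586**: at `γ = id`, `α = β`, two valuation data with DIFFERENT kernels
`unitsHat` make `Thm16ii` FALSE — clause (a) forces `δ = id` (inflation and the Kummer map are injective),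
and clause (b) then says the kernels agree. So the typed fact is a schema for the CANONICAL datum
(`ValuationHatData.canonical`), not a statement uniform in its `V`-parameters.
[cite: MochizukiEtTh2009, Thm 1.6 (ii) p.24] -/
theorem not_thm16ii_refl_of_ne (E : D.KummerData) {V V' : ValuationHatData D E}
    (hV : V.unitsHat ≠ V'.unitsHat) :
    ¬ Thm16ii (ContinuousMulEquiv.refl D.PiTemp) (thm16i_refl D) E E V V' := by
  rintro ⟨c, δ, ha, hb, -⟩
  have hδ : ∀ a, δ a = a := fun a => by
    have h1 := ha a
    rw [transport_refl] at h1
    exact (E.kumYdd_injective (D.inflTheta_injective _ h1)).symm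
  apply hV
  rw [← hb]
  ext x
  constructor
  · rintro hx
    exact ⟨x, hx, hδ x⟩
  · rintro ⟨y, hy, rfl⟩
    rwa [show δ.toMonoidHom y = y from hδ y]

end ThetaSetting

end Literature.AnabelianGeometry.EtaleTheta

end
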